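/-
Copyright (c) 2026 the pub-hodgecm-mathlib formalisation cell (harness21).  Prover seat hodgecm-mathlib-B-p14 (g33), 2026-09-01.  Road «W′» = «R1LL-WILD»
((W′-B6) sub-socket (B6-V), the ρ-side `K`-renormalisation pair of B-p08 (g28)'s 12:03:55Z note — successor hand after B-p08's close 12:04:23Z): how the projective
descent `diag(1,α) u diag(1,α)⁻¹ = s · ι(g)` behaves under conjugation by a unitary LIFT, and the stabiliser lifts of `GL₂(𝒪)`.
-/
import Literature.NumberTheory.Automorphic.UnitaryTwoRamifiedTreeAction          -- ★ p843857∕p843868 (B-p08): `rhoVertexActPlace`, `rhoVertexActPlace_inclusion`, `unitaryGroupOfForm_placeForm_antidiagTwo_eq`; ★ p843783 `rhoVertexAct_eq_glVertexAct`, `exists_mem_unitaryGroupOfForm_conj_eq_smul_map`, `diagonal_mul_diagonal_inv`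
import Literature.NumberTheory.Automorphic.SLTwoTreeQuadraticTorusShellDecomposition -- ★ p843931 (A-p17): `glVertexAct_root_eq_of_mem_glInt`
import Literature.NumberTheory.Automorphic.OrbitalIntegralCosetUnfolding           -- ★ p844020 (this seat): `setIntegral_conj_conj_eq` (the `K`-average is `Ad K`-invariant)
import HarnessLib

/-!
# The projective descent under conjugation by a unitary lift: `d (k⁻¹ X k) d⁻¹ = s · ι(D⁻¹ g D)` — the descent scalar rides along, the lift's scalar cancels
# (ROAD W ∕ road «W′» (B6-V): the `K`-renormalisation of the `K`-average at a shell vertex)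

Topic `NumberTheory/Automorphic`; namespace `Literature.NumberTheory.Automorphic.UnitaryGroup` (that of ★ `UnitaryTwoTreeActionDescent`).  THEOREMS ONLY (no definition,
no instance, no notation, no named fact, no `sorry`); kernel lane.  Cell `pub/hodgecm-mathlib`, crux H413 = stmt-HodgeConjecture-24833; road «W′» = «R1LL-WILD» (architect
A-p16 (g28); (W′-B6) F0P3-p01 (g14) sub-socket (B6-V) «value laws on the torus», holders p08 (g15) ∕ B-p04 (g35)).  This is B-p08 (g28)'s OPEN OFFER «`descent_conj_lift_eq` ∕
`mem_of_conj_descent`» (bus 12:03:55Z, 12:04:23Z) typed by the successor hand.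
HONEST LABEL: HC_CM is proved only modulo the cell's remaining named inputs (hLiu418, h413) until rung 0 closes; `2 × 2` matrix algebra and bookkeeping, print cited for orientation.

THE MATHEMATICS [Serre1980Trees Ch. II §1.2–1.3; Tits1979 §2.7; LabesseLanglands1979 §2 p. 8].  At a non-split place the unitary group `U = U(σ, (0 1; 1 0))(E)` maps to
`PGL₂(F)` by the PROJECTIVE DESCENT `d u d⁻¹ = s_u · ι(g_u)`, `d = diag(1, α)`, `σα = −α` (★ ROAD W (W1)); `g_u` is determined up to `F^×`, but the unitary element is NOT
determined by `g_u` — two elements with the same `g` differ by a central `ζ ∈ E¹` (B-p08's note (1)).  For the `K`-average `∫_K f(k⁻¹ X k) dk` of a test function at the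
conjugate `X = y⁻¹ t y` read at a shell vertex, one renormalises by a unitary LIFT `k̃ ∈ K` of an integral matrix `D ∈ GL₂(𝒪_F)` (`d k̃ d⁻¹ = z · ι(D)`, which exists iff
`σ(z) z ι(det D) = 1`, i.e. `det D ∈ N(E^×)` — ★ `exists_mem_unitaryGroupOfForm_conj_eq_smul_map`; and `k̃` fixes the root since `D ∈ GL₂(𝒪_F)`).  The point (B-p08 (2)):
  `d (k̃⁻¹ X k̃) d⁻¹ = (z · ι D)⁻¹ (s · ι g) (z · ι D) = s · ι(D⁻¹ g D)`
— the descent SCALAR `s` of `X` RIDES ALONG unchanged and the lift's scalar `z` CANCELS; hence the normal form `N := d⁻¹ (s · ι(D⁻¹ g D)) d` IS the unitary element `k̃⁻¹ X k̃`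
(§2), and `∫_K f(k⁻¹ X k) = ∫_K f(k⁻¹ N k)` by `Ad K`-invariance of the `K`-average (★ `setIntegral_conj_conj_eq`) — NO continuity of the lift `k̃` in the torus
parameter is ever needed (B-p08 (3)).

* §1 (pure `GL₂` algebra over `ι : F →+* E`) `descent_inv_eq_inv_smul_map_inv`, **`descent_conj_eq_smul_map_conj`**.
* §2 `coe_inv_mul_mul_eq_conj_smul_map_conj` — the normal form `d⁻¹ (s · ι(D⁻¹ g D)) d` equals `↑(k⁻¹ X k)` (so it lies in `U`).
* §3 STABILISER LIFTS `exists_rhoVertexAct_root_eq_and_descent_eq` (generic) and `exists_rhoVertexActPlace_root_eq_and_descent_eq` (at a place `w ∣ v` of a CM field).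
* §4 the `K`-AVERAGE consequence `setIntegral_conj_eq_of_conj_by_mem` (generic group: `k̃ ∈ K ⇒ ∫_K f(k⁻¹ (k̃⁻¹ X k̃) k) = ∫_K f(k⁻¹ X k)`).

## References
* [Serre1980Trees] J.-P. Serre, *Trees* (1980): Ch. II §1.2–1.3 (`GL₂`, `SL₂`, `PGL₂` of a local field on the tree).
* [Tits1979] J. Tits, *Reductive groups over local fields*, Proc. Sympos. Pure Math. 33 (1979): §2.7.
* [LabesseLanglands1979] J.-P. Labesse, R. P. Langlands, *L-indistinguishability for SL(2)*, Canad. J. Math. 31 (1979): §2 p. 8.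
-/

set_option autoImplicit false

noncomputable section

open scoped Matrix ValuativeRel MatrixGroups
open Matrix ValuativeRel MeasureTheory NumberField IsDedekindDomain

namespace Literature.NumberTheory.Automorphic.UnitaryGroup

open Literature.NumberTheory.Automorphic Literature.NumberTheory.Automorphic.HermitianLatticeTree

/-! ## §1 The projective descent under inversion and under conjugation by a lift -/

section Algebra

variable {F : Type*} [Field F] {E : Type*} [Field E] (ι : F →+* E) {α : E}

/-- Bookkeeping (private): `diag(1,α⁻¹) · (diag(1,α) · Y) = Y`. [folklore] -/
private theorem diagonal_inv_mul_diagonal_mul (hα0 : α ≠ 0) (Y : Matrix (Fin 2) (Fin 2) E) :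
    Matrix.diagonal ![(1 : E), α⁻¹] * (Matrix.diagonal ![1, α] * Y) = Y := by
  rw [← Matrix.mul_assoc, diagonal_inv_mul_diagonal hα0, Matrix.one_mul]

/-- Bookkeeping (private): `Y · (diag(1,α⁻¹) · diag(1,α)) = Y` in right-associated form `Y · (d′ · (d · Z)) = Y · Z`. [folklore] -/
private theorem mul_diagonal_inv_mul_diagonal_mul (hα0 : α ≠ 0) (Y Z : Matrix (Fin 2) (Fin 2) E) :
    Y * (Matrix.diagonal ![(1 : E), α⁻¹] * (Matrix.diagonal ![1, α] * Z)) = Y * Z := by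
  rw [diagonal_inv_mul_diagonal_mul hα0]

/-- **Descent of the inverse**: if `d k d⁻¹ = z · ι(D)` (`d = diag(1,α)`, `z ≠ 0`) then `d k⁻¹ d⁻¹ = z⁻¹ · ι(D⁻¹)` (both sides are left inverses of `z · ι(D)`).
[cite: Serre1980Trees, Ch. II §1.2–1.3] -/
theorem descent_inv_eq_inv_smul_map_inv (hα0 : α ≠ 0) {k : GL (Fin 2) E} {z : E} {D : GL (Fin 2) F} (hz : z ≠ 0)
    (hk : Matrix.diagonal ![1, α] * (k : Matrix (Fin 2) (Fin 2) E) * Matrix.diagonal ![1, α⁻¹] = z • (D : Matrix (Fin 2) (Fin 2) F).map ι) :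
    Matrix.diagonal ![1, α] * ((k⁻¹ : GL (Fin 2) E) : Matrix (Fin 2) (Fin 2) E) * Matrix.diagonal ![1, α⁻¹] =
      z⁻¹ • ((D⁻¹ : GL (Fin 2) F) : Matrix (Fin 2) (Fin 2) F).map ι := by
  have hkk : ∀ Y : Matrix (Fin 2) (Fin 2) E, ((k⁻¹ : GL (Fin 2) E) : Matrix (Fin 2) (Fin 2) E) * ((k : Matrix (Fin 2) (Fin 2) E) * Y) = Y := fun Y => by
    rw [← Matrix.mul_assoc, Units.inv_mul, Matrix.one_mul]
  -- both candidates are left inverses of `d k d⁻¹ = z · ι(D)`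
  have h1 : (Matrix.diagonal ![1, α] * ((k⁻¹ : GL (Fin 2) E) : Matrix (Fin 2) (Fin 2) E) * Matrix.diagonal ![1, α⁻¹]) *
      (Matrix.diagonal ![1, α] * (k : Matrix (Fin 2) (Fin 2) E) * Matrix.diagonal ![1, α⁻¹]) = 1 := by
    simp only [Matrix.mul_assoc, mul_diagonal_inv_mul_diagonal_mul hα0, hkk]
    exact diagonal_mul_diagonal_inv hα0
  have h2 : (z⁻¹ • ((D⁻¹ : GL (Fin 2) F) : Matrix (Fin 2) (Fin 2) F).map ι) *
      (Matrix.diagonal ![1, α] * (k : Matrix (Fin 2) (Fin 2) E) * Matrix.diagonal ![1, α⁻¹]) = 1 := by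
    rw [hk, Matrix.smul_mul, Matrix.mul_smul, smul_smul, inv_mul_cancel₀ hz, one_smul, ← Matrix.map_mul, Units.inv_mul,
      Matrix.map_one ι (map_zero ι) (map_one ι)]
  exact (Matrix.inv_eq_left_inv h1).symm.trans (Matrix.inv_eq_left_inv h2)

/-- **THE DESCENT UNDER CONJUGATION BY A LIFT** (B-p08 (g28)'s `descent_conj_lift_eq`): if `d X d⁻¹ = s · ι(g)` and `d k d⁻¹ = z · ι(D)` with `z ≠ 0`, then
`d (k⁻¹ X k) d⁻¹ = s · ι(D⁻¹ g D)` — the descent scalar `s` of `X` RIDES ALONG, the lift's scalar `z` CANCELS. [cite: Serre1980Trees, Ch. II §1.2–1.3] [cite: Tits1979, §2.7] -/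
theorem descent_conj_eq_smul_map_conj (hα0 : α ≠ 0) {X k : GL (Fin 2) E} {s z : E} {g D : GL (Fin 2) F} (hz : z ≠ 0)
    (hX : Matrix.diagonal ![1, α] * (X : Matrix (Fin 2) (Fin 2) E) * Matrix.diagonal ![1, α⁻¹] = s • (g : Matrix (Fin 2) (Fin 2) F).map ι)
    (hk : Matrix.diagonal ![1, α] * (k : Matrix (Fin 2) (Fin 2) E) * Matrix.diagonal ![1, α⁻¹] = z • (D : Matrix (Fin 2) (Fin 2) F).map ι) :
    Matrix.diagonal ![1, α] * ((k⁻¹ * X * k : GL (Fin 2) E) : Matrix (Fin 2) (Fin 2) E) * Matrix.diagonal ![1, α⁻¹] =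
      s • ((D⁻¹ * g * D : GL (Fin 2) F) : Matrix (Fin 2) (Fin 2) F).map ι := by
  have hsplit : Matrix.diagonal ![1, α] * ((k⁻¹ * X * k : GL (Fin 2) E) : Matrix (Fin 2) (Fin 2) E) * Matrix.diagonal ![1, α⁻¹] =
      (Matrix.diagonal ![1, α] * ((k⁻¹ : GL (Fin 2) E) : Matrix (Fin 2) (Fin 2) E) * Matrix.diagonal ![1, α⁻¹]) *
        (Matrix.diagonal ![1, α] * (X : Matrix (Fin 2) (Fin 2) E) * Matrix.diagonal ![1, α⁻¹]) *
        (Matrix.diagonal ![1, α] * (k : Matrix (Fin 2) (Fin 2) E) * Matrix.diagonal ![1, α⁻¹]) := by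
    rw [Units.val_mul, Units.val_mul]
    simp only [Matrix.mul_assoc, mul_diagonal_inv_mul_diagonal_mul hα0]
  rw [hsplit, descent_inv_eq_inv_smul_map_inv ι hα0 hz hk, hX, hk]
  simp only [Matrix.smul_mul, Matrix.mul_smul, smul_smul]
  rw [← Matrix.map_mul, ← Matrix.map_mul, ← Units.val_mul, ← Units.val_mul]
  congr 1
  field_simp

/-! ## §2 The normal form is a unitary element -/

/-- **`mem_of_conj_descent`** (B-p08 (g28)): under the same hypotheses the NORMAL FORM `d⁻¹ · (s · ι(D⁻¹ g D)) · d` EQUALS `↑(k⁻¹ X k)` — in particular it is (the matrix of) an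
element of the unitary group whenever `X` and `k` are. [cite: Serre1980Trees, Ch. II §1.2–1.3] [cite: Tits1979, §2.7] -/
theorem coe_inv_mul_mul_eq_conj_smul_map_conj (hα0 : α ≠ 0) {X k : GL (Fin 2) E} {s z : E} {g D : GL (Fin 2) F} (hz : z ≠ 0)
    (hX : Matrix.diagonal ![1, α] * (X : Matrix (Fin 2) (Fin 2) E) * Matrix.diagonal ![1, α⁻¹] = s • (g : Matrix (Fin 2) (Fin 2) F).map ι)
    (hk : Matrix.diagonal ![1, α] * (k : Matrix (Fin 2) (Fin 2) E) * Matrix.diagonal ![1, α⁻¹] = z • (D : Matrix (Fin 2) (Fin 2) F).map ι) :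
    ((k⁻¹ * X * k : GL (Fin 2) E) : Matrix (Fin 2) (Fin 2) E) =
      Matrix.diagonal ![1, α⁻¹] * (s • ((D⁻¹ * g * D : GL (Fin 2) F) : Matrix (Fin 2) (Fin 2) F).map ι) * Matrix.diagonal ![1, α] := by
  rw [← descent_conj_eq_smul_map_conj ι hα0 hz hX hk]
  simp only [Matrix.mul_assoc, diagonal_inv_mul_diagonal_mul hα0, diagonal_inv_mul_diagonal hα0, Matrix.mul_one]

end Algebra

/-! ## §3 Stabiliser lifts of integral matrices -/

section Lift

variable {F : Type*} [Field F] {E : Type*} [Field E] (ι : F →+* E) (σ : E →+* E) {α : E}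
  [ValuativeRel F] {ϖ : F} (hϖ : IsUniformizingElement ϖ) [IsDiscreteValuationRing 𝒪[F]]
  (hρ : ∀ u : GL (Fin 2) E, u ∈ unitaryGroupOfForm σ !![(0 : E), 1; 1, 0] →
      ∃ (s : E) (g : GL (Fin 2) F), s ≠ 0 ∧ Matrix.diagonal ![1, α] * (u : Matrix (Fin 2) (Fin 2) E) * Matrix.diagonal ![1, α⁻¹] =
        s • (g : Matrix (Fin 2) (Fin 2) F).map ι)

include hϖ in
/-- **STABILISER LIFT** (generic): for `D ∈ GL₂(𝒪_F)` and a scalar `z` with `σ(z) z ι(det D) = 1` (i.e. `det D ∈ N(E^×)` up to the choice of `z`) there is a unitary `k̃` with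
descent `d k̃ d⁻¹ = z · ι(D)` that FIXES THE ROOT `x₀ = 𝒪_F²` (★ `exists_mem_unitaryGroupOfForm_conj_eq_smul_map` + ★ `rhoVertexAct_eq_glVertexAct` + ★ `glVertexAct_root_eq_of_mem_glInt`).
[cite: Serre1980Trees, Ch. II §1.3] [cite: Tits1979, §2.7] -/
theorem exists_rhoVertexAct_root_eq_and_descent_eq (hσι : ∀ x : F, σ (ι x) = ι x) (hα : σ α = -α) (hα0 : α ≠ 0)
    {z : E} {D : GL (Fin 2) F} (hD : D ∈ glInt 2 F) (hzD : σ z * z * ι (D : Matrix (Fin 2) (Fin 2) F).det = 1)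
    (x₀ : {M : Submodule 𝒪[F] (Fin 2 → F) // IsSpecialLattice (RingHom.id F) ϖ !![(0 : F), 1; -1, 0] M})
    (hx₀ : x₀.1 = latt (1 : Matrix (Fin 2) (Fin 2) F)) :
    ∃ kt : ↥(unitaryGroupOfForm σ !![(0 : E), 1; 1, 0]),
      rhoVertexAct ι σ hϖ hρ kt x₀ = x₀ ∧
        Matrix.diagonal ![1, α] * ((kt : GL (Fin 2) E) : Matrix (Fin 2) (Fin 2) E) * Matrix.diagonal ![1, α⁻¹] = z • (D : Matrix (Fin 2) (Fin 2) F).map ι := by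
  obtain ⟨kt, hkt⟩ := exists_mem_unitaryGroupOfForm_conj_eq_smul_map ι σ hσι hα hα0 hzD
  have hz : z ≠ 0 := by
    rintro rfl
    rw [mul_zero, zero_mul] at hzD
    exact zero_ne_one hzD
  exact ⟨kt, by rw [rhoVertexAct_eq_glVertexAct ι σ hϖ hρ kt hz hkt, glVertexAct_root_eq_of_mem_glInt hϖ hD x₀ hx₀], hkt⟩

end Lift

section Place

variable (L : Type) [Field L] [NumberField L] [IsCMField L] (v : HeightOneSpectrum (𝓞 ↥(maximalRealSubfield L)))
  (w : PlacesOver L v) (hw : IsCMField.complexConj L • w.1 = w.1)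
  {α : w.1.adicCompletion L} (hα : galAdicCompletionMap (L := L) (IsCMField.complexConj L) hw α = -α) (hα0 : α ≠ 0)
  {ϖF : v.adicCompletion ↥(maximalRealSubfield L)} (hϖF : Valued.v ϖF = WithZero.exp (-1 : ℤ))

/-- **STABILISER LIFT AT A PLACE** `w ∣ v` of a CM field: for `D ∈ GL₂(𝒪_v)` and `z ∈ L_w` with `σ_w(z) z ι(det D) = 1` there is `k̃ ∈ U_w = U(σ_w, (Φ₂)_w)(L_w)` with descent
`diag(1,α) k̃ diag(1,α)⁻¹ = z · ι(D)` and `ρ_w(k̃)·x₀ = x₀` (so `k̃` lies in every root-stabiliser level `K`, ★ p843891). [cite: Serre1980Trees, Ch. II §1.3] [cite: Tits1979, §2.7] -/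
theorem exists_rhoVertexActPlace_root_eq_and_descent_eq [IsDiscreteValuationRing 𝒪[v.adicCompletion ↥(maximalRealSubfield L)]]
    {z : w.1.adicCompletion L} {D : GL (Fin 2) (v.adicCompletion ↥(maximalRealSubfield L))} (hD : D ∈ glInt 2 (v.adicCompletion ↥(maximalRealSubfield L)))
    (hzD : galAdicCompletionMap (L := L) (IsCMField.complexConj L) hw z * z * toPlace v w (D : Matrix (Fin 2) (Fin 2) _).det = 1)
    (x₀ : {M : Submodule 𝒪[v.adicCompletion ↥(maximalRealSubfield L)] (Fin 2 → v.adicCompletion ↥(maximalRealSubfield L)) //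
      IsSpecialLattice (RingHom.id _) ϖF !![(0 : v.adicCompletion ↥(maximalRealSubfield L)), 1; -1, 0] M})
    (hx₀ : x₀.1 = latt (1 : Matrix (Fin 2) (Fin 2) (v.adicCompletion ↥(maximalRealSubfield L)))) :
    ∃ kt : ↥(unitaryGroupOfForm (galAdicCompletionMap (L := L) (IsCMField.complexConj L) hw)
        (placeForm (Matrix.of fun i j : Fin 2 => if i.val + j.val + 1 = 2 then (1 : L) else 0) w.1)),
      rhoVertexActPlace L v w hw hα hα0 hϖF kt x₀ = x₀ ∧
        Matrix.diagonal ![1, α] * ((kt : GL (Fin 2) (w.1.adicCompletion L)) : Matrix (Fin 2) (Fin 2) (w.1.adicCompletion L)) * Matrix.diagonal ![1, α⁻¹] =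
          z • (D : Matrix (Fin 2) (Fin 2) (v.adicCompletion ↥(maximalRealSubfield L))).map (toPlace v w) := by
  have hσι : ∀ x, galAdicCompletionMap (L := L) (IsCMField.complexConj L) hw (toPlace v w x) = toPlace v w x :=
    fun x => galAdicCompletionMap_toPlace (IsCMField.complexConj L) w w hw x
  obtain ⟨kt, hroot, hdesc⟩ := exists_rhoVertexAct_root_eq_and_descent_eq (toPlace v w) (galAdicCompletionMap (L := L) (IsCMField.complexConj L) hw)
    (isUniformizingElement_of_v_eq hϖF) (descent_of_mem_unitaryGroupOfForm_antidiag L v w hw hα hα0) hσι hα hα0 hD hzD x₀ hx₀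
  refine ⟨Subgroup.inclusion (unitaryGroupOfForm_placeForm_antidiagTwo_eq L v w _).ge kt, ?_, ?_⟩
  · rw [rhoVertexActPlace_inclusion]
    exact hroot
  · rw [Subgroup.coe_inclusion]
    exact hdesc

end Place

end Literature.NumberTheory.Automorphic.UnitaryGroup

/-! ## §4 The `K`-average consequence (generic group) -/

namespace Literature.NumberTheory.Automorphic

section Average

variable {G : Type*} [Group G] [TopologicalSpace G] [IsTopologicalGroup G] [MeasurableSpace G] [BorelSpace G]
  (ν : Measure G) [ν.IsMulLeftInvariant] (K : Subgroup G) {E : Type*} [NormedAddCommGroup E] [NormedSpace ℝ E]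

/-- **RENORMALISING THE `K`-AVERAGE BY AN ELEMENT OF `K`**: if `k̃ ∈ K` then `∫_K f(k⁻¹ (k̃⁻¹ X k̃) k) dν(k) = ∫_K f(k⁻¹ X k) dν(k)` — so the `K`-average of `f` at a shell
conjugate `X` may be computed at its NORMAL FORM `k̃⁻¹ X k̃` (§2), and no continuity of the lift `k̃` in any parameter is needed. (★ `setIntegral_conj_conj_eq` at `k₀ = k̃⁻¹`.)
[cite: LabesseLanglands1979, §2 p. 8] -/
theorem setIntegral_conj_eq_of_conj_by_mem (hK : IsOpen (K : Set G)) (f : G → E) {kt : G} (hkt : kt ∈ K) (X : G) :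
    ∫ k in (K : Set G), f (k⁻¹ * (kt⁻¹ * X * kt) * k) ∂ν = ∫ k in (K : Set G), f (k⁻¹ * X * k) ∂ν := by
  have h := setIntegral_conj_conj_eq K ν hK f (K.inv_mem hkt) X
  rwa [inv_inv] at h

end Average

end Literature.NumberTheory.Automorphic

end
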